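import Summits.BirchSwinnertonDyer.BirchSwinnertonDyer.Theorems.ByReductionTypeAtTwoAdditivePotGoodPrintKrizLi92a1
import HarnessLib

/-!
# K4 crux `AdditiveRankZeroAtTwo` (19098), children C3″ (22617) / C1″ (22615): the Kriz–Li road at `92a1` is NOT VACUOUS — the index set
# `𝒩(92a1, ℚ(√−7))` from explicit congruences and the member `d = 29` (`a₂₉(92a1) = −3` odd, `(−7/29) = 1`, `29 ≡ 1 (mod 4)`,
# `χ_{29}(−92) = (92/29) = 1`): `BSD(·, 2)` with both K4 halves at every global minimal `92a1^{(29)}` (rank `0`) and `BSD(·, 2)` at every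
# global minimal `92a1^{(−203)}` (rank `1`); and the Zhai-1.1 member `92a1^{(−3)}` (`a₃ = 1` odd)

Cell `bsd-2adic`, seat `bsd-2adic-k4-w2` GEN 7 (prover, explicit unit, no kit); `--supports stmt-BirchSwinnertonDyer-22617 --as helper`;
companion of `…PrintKrizLi92a1.lean`. HONEST FRAMING (D-0036/D-0054): kernel certificates of Kriz–Li's membership conditions (Def 4.1: `ℓ ∤ 2N`,
`ℓ` split in `K`, `a_ℓ(E)` odd — by a certified point count `#Ẽ(𝔽₂₉) = 33`; `d ≡ 1 (mod 4)` square-free; `χ_d(−N) = sgn(d)·(N/|d|) = 1` with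
`N = 92` exact) and the road's conclusions at the two members, from the by-name theorems of the companion file (inputs: Thm 5.1 (2), Thm 4.3,
Table-2 row `92a1`, Creutz–Miller, ARS, GZK; displayed `r_an(92a1) = 0`). The first members of `𝒩(92a1, ℚ(√−7))` with `χ_d(−92) = 1` are
`d = 29, −71, −127, −151, −163, −179, 193, 197, …` (seat script `tools/krizli_data.py`). Closes nothing at the `∀`-level; nothing booked;
BSD is not proved by any of this.

References: [KrizLi2019] Def 4.1, Thm 5.1 (2), §6 Table 2 (row 92a1); [SilvermanAEC2009] V.2 (point counts); [Marcus1977] Ch. 3 Thm. 25.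
-/

set_option autoImplicit false
-- the Theorems namespace of this sub repeats the summit name by design (D-0017 nested layout)
set_option linter.dupNamespace false

noncomputable section

open scoped Classical

open WeierstrassCurve NumberField Literature.NumberTheory.EllipticCurves
  Literature.NumberTheory.EllipticCurves.ModularForms
  Literature.NumberTheory.EllipticCurves.Rank1Residual
  Literature.NumberTheory.EllipticCurves.Rank1Residual.Typed
  Literature.NumberTheory.EllipticCurves.AgasheRibetStein2006
  Summit.BirchSwinnertonDyer
  Summit.BirchSwinnertonDyer.Rank1Residual
  Summit.BirchSwinnertonDyer.Rank1Residual.X11b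
  Summit.BirchSwinnertonDyer.Rank1Residual.X5.O1
  Summit.BirchSwinnertonDyer.Rank1Residual.P2
  Summit.BirchSwinnertonDyer.BirchSwinnertonDyer.Rank1Residual.IntModel
  Summit.BirchSwinnertonDyer.BirchSwinnertonDyer.Theorems

namespace Summit.BirchSwinnertonDyer.BirchSwinnertonDyer.Theorems.AddPotGoodPrint

/-! ## §1 `ℓ ∈ 𝒮(92a1, K)` and `d ∈ 𝒩(92a1, K)` from explicit congruences (`d_K = −7`, `N = 92`) -/
section IndexSet92A1

/-- **`ℓ ∈ 𝒮(92a1, K)`** (Kriz–Li Def 4.1) from: `ℓ` prime, `ℓ ∉ {2, 23}` (`⟺ ℓ ∤ 2N = 184`), `(−7/ℓ) = 1` (`ℓ` splits in `K`), `a_ℓ(92a1)` odd.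
[cite: KrizLi2019, Def. 4.1 (FMS) = arXiv Def. 3.1] [cite: Marcus1977, Ch. 3 Thm. 25] -/
theorem inS_92A1 {K : Type} [Field K] [NumberField K] (h2 : Module.finrank ℚ K = 2) (hdK : NumberField.discr K = -7)
    {ℓ : ℕ} (hℓ : ℓ.Prime) (hℓ2 : ℓ ≠ 2) (hℓ23 : ℓ ≠ 23) (hj : jacobiSym (-7) ℓ = 1)
    (hodd : haveI := isGloballyMinimal_92A1; Odd ((⟨0, 1, 0, 2, 1⟩ : WeierstrassCurve ℚ).frobeniusTrace ℓ)) :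
    haveI := isGloballyMinimal_92A1
    KrizLi2019.InS (⟨0, 1, 0, 2, 1⟩ : WeierstrassCurve ℚ) K ℓ := by
  haveI := isElliptic_92A1; haveI := isGloballyMinimal_92A1
  refine ⟨hℓ, ?_, ?_, hodd⟩
  · rw [conductorNorm_92A1]
    intro h
    have h' : ℓ ∣ 2 ^ 3 * 23 := by simpa using h
    rcases (Nat.Prime.dvd_mul hℓ).mp h' with h | h
    · exact hℓ2 ((Nat.prime_dvd_prime_iff_eq hℓ Nat.prime_two).mp (hℓ.dvd_of_dvd_pow h))
    · exact hℓ23 ((Nat.prime_dvd_prime_iff_eq hℓ (by norm_num)).mp h)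
  · rw [Literature.NumberTheory.QuadraticFields.Quadratic.ncard_primesOver_eq_two_iff_jacobiSym h2 hℓ hℓ2, hdK]
    exact hj

/-- **`d ∈ 𝒩(92a1, K)`** (Kriz–Li Def 4.1: `d ≡ 1 (mod 4)`, `|d|` a square-free product of primes in `𝒮`) from the explicit conditions on
the prime factors. [cite: KrizLi2019, Def. 4.1 (FMS) = arXiv Def. 3.1] -/
theorem inN_92A1 {K : Type} [Field K] [NumberField K] (h2 : Module.finrank ℚ K = 2) (hdK : NumberField.discr K = -7)
    {d : ℤ} (hd4 : d % 4 = 1) (hsq : Squarefree d.natAbs)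
    (hprimes : haveI := isGloballyMinimal_92A1; ∀ ℓ : ℕ, ℓ.Prime → ℓ ∣ d.natAbs →
      ℓ ≠ 2 ∧ ℓ ≠ 23 ∧ jacobiSym (-7) ℓ = 1 ∧ Odd ((⟨0, 1, 0, 2, 1⟩ : WeierstrassCurve ℚ).frobeniusTrace ℓ)) :
    haveI := isGloballyMinimal_92A1
    KrizLi2019.InN (⟨0, 1, 0, 2, 1⟩ : WeierstrassCurve ℚ) K d :=
  ⟨hd4, hsq, fun ℓ hℓ hℓd =>
    inS_92A1 h2 hdK hℓ (hprimes ℓ hℓ hℓd).1 (hprimes ℓ hℓ hℓd).2.1 (hprimes ℓ hℓ hℓd).2.2.1 (hprimes ℓ hℓ hℓd).2.2.2⟩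

/-- **The sign condition `χ_d(−92) = 1`, read with `N = 92` exact**: it is `sgn(d)·(92/|d|) = 1`. [cite: KrizLi2019, Thm. 5.1 (2) condition "χ_d(−N) = 1"] -/
theorem sign_92A1 {d : ℤ} (h : Int.sign d * jacobiSym 92 d.natAbs = 1) :
    haveI := isElliptic_92A1
    Int.sign d * jacobiSym ((⟨0, 1, 0, 2, 1⟩ : WeierstrassCurve ℚ).conductorNorm ℤ) d.natAbs = 1 := by
  rw [conductorNorm_92A1]; exact_mod_cast h

end IndexSet92A1

/-! ## §2 The witness `ℓ = 29`: `a₂₉(92a1) = −3` odd, `29` splits in `ℚ(√−7)`; `d = 29 ∈ 𝒩`, `χ_{29}(−92) = 1` -/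
section Witness92A1pos29

/-- **`#Ẽ(𝔽₂₉) = 33` for `92a1`** (certified count; `29 ∤ Δ = −368`), so `a₂₉ = 30 − 33 = −3`. [cite: SilvermanAEC2009, V.2] -/
theorem reductionPointCount_29_92A1 [(⟨0, 1, 0, 2, 1⟩ : WeierstrassCurve ℚ).IsGloballyMinimal] :
    (⟨0, 1, 0, 2, 1⟩ : WeierstrassCurve ℚ).reductionPointCount 29 = 33 := by
  haveI : Fact (Nat.Prime 29) := ⟨by norm_num⟩
  haveI := isElliptic_92A1
  exact Supersingular.reductionPointCount_eq_of_intModel_countPoints intModel_92A1 29 (by norm_num) (by decide +kernel)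
    (by decide +kernel)

/-- **`a₂₉(92a1)` is odd** (`= −3`): `Frob₂₉` has order `3` on `E[2]` — Kriz–Li's condition for `29 ∈ 𝒮`. [cite: KrizLi2019, Def. 4.1 ("Frob_ℓ of order 3")] -/
theorem odd_frobeniusTrace_29_92A1 [(⟨0, 1, 0, 2, 1⟩ : WeierstrassCurve ℚ).IsGloballyMinimal] :
    Odd ((⟨0, 1, 0, 2, 1⟩ : WeierstrassCurve ℚ).frobeniusTrace 29) := by
  rw [Uniform.U2.odd_frobeniusTrace_iff_odd_reductionPointCount _ (by norm_num : Nat.Prime 29) (by norm_num),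
    reductionPointCount_29_92A1]
  decide

/-- **`29 ∈ 𝒩(92a1, K)`** for every quadratic `K` with `d_K = −7`: `29 ≡ 1 (mod 4)`, `29` prime `∉ {2, 23}`, `(−7/29) = (22/29) = 1`, `a₂₉` odd.
[cite: KrizLi2019, Def. 4.1] -/
theorem inN_29_92A1 {K : Type} [Field K] [NumberField K] (h2 : Module.finrank ℚ K = 2) (hdK : NumberField.discr K = -7) :
    haveI := isGloballyMinimal_92A1
    KrizLi2019.InN (⟨0, 1, 0, 2, 1⟩ : WeierstrassCurve ℚ) K 29 := by
  haveI := isGloballyMinimal_92A1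
  have h29 : Nat.Prime 29 := by norm_num
  have hna : (29 : ℤ).natAbs = 29 := rfl
  refine inN_92A1 h2 hdK (by decide) (by rw [hna]; exact h29.squarefree) fun ℓ hℓ hℓd => ?_
  rw [hna] at hℓd
  obtain rfl := (Nat.prime_dvd_prime_iff_eq hℓ h29).mp hℓd
  exact ⟨by norm_num, by norm_num, by norm_num, odd_frobeniusTrace_29_92A1⟩

/-- **`χ_{29}(−92) = 1`**: `sgn(29)·(92/29) = (5/29) = 1`. [cite: KrizLi2019, Thm. 5.1 (2) condition "χ_d(−N) = 1"] -/
theorem sign_29_92A1 :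
    haveI := isElliptic_92A1
    Int.sign 29 * jacobiSym ((⟨0, 1, 0, 2, 1⟩ : WeierstrassCurve ℚ).conductorNorm ℤ) (29 : ℤ).natAbs = 1 :=
  sign_92A1 (by rw [show (29 : ℤ).natAbs = 29 from rfl]; norm_num)

/-- **C3″'s conclusion AND the Kato-side half at every global minimal model of `92a1^{(29)}`** (the member `d = 29` of the Kriz–Li family;
`K` any quadratic field with `d_K = −7`): `r_an = 0 ∧ Addv ∧ 0 ≤ ord₂ j ∧ ¬CM ∧ Irr ∧ BSD(·,2) ∧ MissingLower ∧ MissingUpper`. By name: Kriz–Li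
Thm 5.1 (2) + 4.3 + Table-2 row, Creutz–Miller, ARS, GZK; displayed: `r_an(92a1) = 0`. The `92a1` road is not vacuous. BSD is not proved by
any of this. [cite: KrizLi2019, Thm. 5.1 (2), Thm. 4.3, §6 Table 2 (row 92a1)] [cite: CreutzMiller2012, Thm. 1.1] [cite: AgasheRibetStein2006, Thm. 2.6]
[cite: Miller2011LMS, Def. 1.1] -/
theorem printFamily92A1_krizLi_witness29 (hKL : KrizLi2019.thm112_bsdTwo_twist) (h33 : KrizLi2019.thm33_rank_twist)
    (htab : KrizLi2019.table2_row92a1) (hS31 : bsdTriple_of_analyticRank_le_one_of_conductor_lt)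
    (h26 : cremona_abs_maninConstant_eq_one_of_level_le) (hGZK : rank_eq_analyticRank_of_analyticRank_le_one)
    (hr : haveI := isElliptic_92A1; (⟨0, 1, 0, 2, 1⟩ : WeierstrassCurve ℚ).analyticRank = 0)
    (K : Type) [Field K] [NumberField K] (hK : IsImaginaryQuadratic K) (hdK : NumberField.discr K = -7)
    (W₁ : WeierstrassCurve ℚ) [W₁.IsElliptic] [W₁.IsGloballyMinimal]
    (hW₁ : ∃ C : VariableChange ℚ, C • (⟨0, 1, 0, 2, 1⟩ : WeierstrassCurve ℚ).quadraticTwist ((29 : ℤ) : ℚ) = W₁) :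
    haveI : Fact (Nat.Prime 2) := ⟨Nat.prime_two⟩
    W₁.analyticRank = 0 ∧ Addv W₁ 2 ∧ 0 ≤ padicValRat 2 W₁.j ∧ ¬ W₁.HasCM ∧ Irr W₁ 2 ∧
      BSDp W₁ 2 ∧ MissingLowerBoundAt W₁ 2 ∧ MissingUpperBoundAt W₁ 2 :=
  printFamily92A1_krizLi_rankZero hKL h33 htab hS31 h26 hGZK hr K hK hdK (inN_29_92A1 hK.1 hdK) sign_29_92A1 W₁ hW₁

/-- **The rank-one companion `92a1^{(−203)}`** (`−203 = (−7)·29`): at every global minimal model, `r_an = 1 ∧ Addv ∧ 0 ≤ ord₂ j ∧ ¬CM ∧ Irr ∧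
BSD(·, 2)`. BSD is not proved by any of this. [cite: KrizLi2019, Thm. 5.1 (2), Thm. 4.3, §6 Table 2 (row 92a1)] [cite: CreutzMiller2012, Thm. 1.1]
[cite: Miller2011LMS, Def. 1.1] -/
theorem printFamily92A1_krizLi_witness_neg203 (hKL : KrizLi2019.thm112_bsdTwo_twist) (h33 : KrizLi2019.thm33_rank_twist)
    (htab : KrizLi2019.table2_row92a1) (hS31 : bsdTriple_of_analyticRank_le_one_of_conductor_lt)
    (h26 : cremona_abs_maninConstant_eq_one_of_level_le)
    (hr : haveI := isElliptic_92A1; (⟨0, 1, 0, 2, 1⟩ : WeierstrassCurve ℚ).analyticRank = 0)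
    (K : Type) [Field K] [NumberField K] (hK : IsImaginaryQuadratic K) (hdK : NumberField.discr K = -7)
    (W₂ : WeierstrassCurve ℚ) [W₂.IsElliptic] [W₂.IsGloballyMinimal]
    (hW₂ : ∃ C : VariableChange ℚ, C • (⟨0, 1, 0, 2, 1⟩ : WeierstrassCurve ℚ).quadraticTwist ((-203 : ℤ) : ℚ) = W₂) :
    haveI : Fact (Nat.Prime 2) := ⟨Nat.prime_two⟩
    W₂.analyticRank = 1 ∧ Addv W₂ 2 ∧ 0 ≤ padicValRat 2 W₂.j ∧ ¬ W₂.HasCM ∧ Irr W₂ 2 ∧ BSDp W₂ 2 :=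
  printFamily92A1_krizLi_rankOne hKL h33 htab hS31 h26 hr K hK hdK (inN_29_92A1 hK.1 hdK) sign_29_92A1 W₂
    (by rw [show ((-7 * 29 : ℤ) : ℚ) = ((-203 : ℤ) : ℚ) by norm_num]; exact hW₂)

end Witness92A1pos29

/-! ## §3 The Zhai-1.1 road at `92a1` is not vacuous either: the member `M = 3* = −3` (`a₃(92a1) = 1` odd ⇒ `3` inert in the cubic field) -/
section ZhaiWitness92A1

/-- **`#Ẽ(𝔽₃) = 3` for `92a1`** (certified count; `3 ∤ Δ = −368`), so `a₃ = 1`. [cite: SilvermanAEC2009, V.2] -/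
theorem reductionPointCount_3_92A1 [(⟨0, 1, 0, 2, 1⟩ : WeierstrassCurve ℚ).IsGloballyMinimal] :
    (⟨0, 1, 0, 2, 1⟩ : WeierstrassCurve ℚ).reductionPointCount 3 = 3 := by
  haveI : Fact (Nat.Prime 3) := ⟨by norm_num⟩
  haveI := isElliptic_92A1
  exact Supersingular.reductionPointCount_eq_of_intModel_countPoints intModel_92A1 3 (by norm_num) (by decide +kernel)
    (by decide +kernel)

/-- **`a₃(92a1) = 1` is odd**: `3` is inert in the cubic `2`-division field of `92a1` (Zhai's twisting condition). [cite: Zhai2016, Thm. 1.1 (hypothesis "inert in F")] -/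
theorem odd_frobeniusTrace_3_92A1 [(⟨0, 1, 0, 2, 1⟩ : WeierstrassCurve ℚ).IsGloballyMinimal] :
    Odd ((⟨0, 1, 0, 2, 1⟩ : WeierstrassCurve ℚ).frobeniusTrace 3) := by
  rw [Uniform.U2.odd_frobeniusTrace_iff_odd_reductionPointCount _ (by norm_num : Nat.Prime 3) (by norm_num),
    reductionPointCount_3_92A1]
  decide

/-- **C3″'s conclusion at every global minimal model of `92a1^{(−3)}`** — the member `M = 3* = −3` of the Zhai-1.1 family of `92a1`
(`−3 ≡ 1 (mod 4)` square-free, `(3, N) = 1` since `N = 92`, `3` inert in the cubic `2`-division field because `a₃ = 1` is odd — kernel;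
`F` exists by `U2.exists_isTwoDivisionField`). Displayed: the optimality datum and the record `ord₂(L(92a1,1)/Ω_∞) = 0`; by name: Zhai
Thm. 1.1 (corrected), ARS Thm. 2.6, modularity. BSD is not proved by any of this. [cite: Zhai2016, Thm. 1.1] [cite: AgasheRibetStein2006, Thm. 2.6] [cite: Miller2011LMS, Def. 1.1] -/
theorem printFamily92A1_witness_neg3 (h11 : Zhai2016.thm11_ordTwo_LAlg_twist_eq_zero')
    (h26 : cremona_abs_maninConstant_eq_one_of_level_le) (hmod : hasEntireLFunction_rat)
    [hN : haveI := isElliptic_92A1; NeZero ((⟨0, 1, 0, 2, 1⟩ : WeierstrassCurve ℚ).conductorNorm ℤ)]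
    (Dt : haveI := isElliptic_92A1; ModularParametrizationData (⟨0, 1, 0, 2, 1⟩ : WeierstrassCurve ℚ) ((⟨0, 1, 0, 2, 1⟩ : WeierstrassCurve ℚ).conductorNorm ℤ))
    (hopt : haveI := isElliptic_92A1; Zhai2021.IsOptimalDatum (⟨0, 1, 0, 2, 1⟩ : WeierstrassCurve ℚ) Dt)
    (hL : haveI := isElliptic_92A1; ∃ x : ℚ, Zhai2016.IsLAlg (⟨0, 1, 0, 2, 1⟩ : WeierstrassCurve ℚ) x ∧ x ≠ 0 ∧ padicValRat 2 x = 0)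
    (W : WeierstrassCurve ℚ) [W.IsElliptic] [W.IsGloballyMinimal]
    (hW : ∃ C : VariableChange ℚ, C • (⟨0, 1, 0, 2, 1⟩ : WeierstrassCurve ℚ).quadraticTwist ((-3 : ℤ) : ℚ) = W) :
    haveI : Fact (Nat.Prime 2) := ⟨Nat.prime_two⟩
    W.analyticRank = 0 ∧ Addv W 2 ∧ 0 ≤ padicValRat 2 W.j ∧ ¬ W.HasCM ∧ Irr W 2 ∧ MissingLowerBoundAt W 2 := by
  haveI : Fact (Nat.Prime 2) := ⟨Nat.prime_two⟩
  haveI := isElliptic_92A1; haveI := isGloballyMinimal_92A1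
  have hq : Nat.Prime 3 := by norm_num
  obtain ⟨F, _, _, hF⟩ := Uniform.U2.exists_isTwoDivisionField (⟨0, 1, 0, 2, 1⟩ : WeierstrassCurve ℚ)
    ((X5.O1.irr_two_iff_forall_two_nsmul _).mp irr_two_92A1)
  have hgood : ¬ ((3 : ℕ) : ℤ) ∣ minimalDiscriminantInt (⟨0, 1, 0, 2, 1⟩ : WeierstrassCurve ℚ) := by
    rw [minimalDiscriminantInt_eq intModel_92A1, M92A1_Δ]; decide
  have hin : Zhai2016.IsInertIn F 3 :=
    Uniform.U2.isInertIn_of_odd_frobeniusTrace _ hF hq (by norm_num) hgood odd_frobeniusTrace_3_92A1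
  have hna : (-3 : ℤ).natAbs = 3 := rfl
  have hgcd : Int.gcd (-3 : ℤ) ((⟨0, 1, 0, 2, 1⟩ : WeierstrassCurve ℚ).conductorNorm ℤ) = 1 := by
    rw [conductorNorm_92A1]; decide
  refine printFamily92A1_lower h11 h26 hmod Dt hopt hL F hF (-3 : ℤ) ?_ (by decide) hgcd ?_ ?_ W hW
  · rw [← Int.squarefree_natAbs, hna]; exact hq.prime.squarefree
  · exact ⟨3, by rw [hna, Nat.Prime.primeFactors hq]; simp⟩
  · intro p hp
    rw [hna, Nat.Prime.primeFactors hq, Finset.mem_singleton] at hp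
    subst hp
    exact ⟨by norm_num, hin⟩

end ZhaiWitness92A1

end Summit.BirchSwinnertonDyer.BirchSwinnertonDyer.Theorems.AddPotGoodPrint

end
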